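import Literature.AlgebraicGeometry.ComplexMultiplication.CMTypeOfConjugateStructure
import Literature.AlgebraicGeometry.ComplexMultiplication.CMTypeRealisationIsogenyTransport
import Literature.AlgebraicGeometry.Motives.AbelianVarietyConjugateBaseChangeAlong
import Literature.NumberTheory.ComplexMultiplication.ShimuraTaniyamaHecke
import HarnessLib

/-!
# The conjugate of a structure of type `(K, Φ)` over a number field is of type `(K, σΦ)`

Topic `NumberTheory/ComplexMultiplication`; namespace `Literature.NumberTheory.ComplexMultiplication`.  THEOREMS ONLY
(no definition, no named fact).  Cell hodgecm-mathlib, fan B, rung B-II, row II-1 (b2-main-theorem-cm v2c, sha16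
a602374d356db67e), registered stub **S8 `stub_conjugateType : StubConjugateType`** (:124–:131), closed BY NAME:
`theorem stub_conjugateType : StubConjugateType := isCMTypeRealisationOver_conjugate` (binder list verbatim).
HC_CM is proved only modulo the 7 printed citations until rung 0 closes; nothing here changes that.

## Statement

For a CM field `K`, a CM type `Φ` of `K` (valued in `ℂ`), a number field `L ⊂ ℂ`, a structure `(A₀, ι₀)` of type
`(K, Φ)` over `L` (`IsCMTypeRealisationOver Φ A₀ ι₀`: the complexification `(A₀ ⊗_L ℂ, ι₀ ⊗ ℂ)` is of type `(K; Φ)`),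
an automorphism `σ ∈ Aut(ℂ)` and `γ ∈ Aut(L)` INDUCED by `σ` (`σ ∘ (L → ℂ) = (L → ℂ) ∘ γ`), the conjugate structure
`(A₀^γ, ι₀^γ)` (`AbelianVariety.conjugate`, `endConjugate`) is of type `(K, σΦ)` over `L`, `σΦ = cmTypeSmul σ Φ`
(`{σ ∘ φ : φ ∈ Φ}`): [Shimura1998] §8.5 p. 89 L1–3 («`δι(ξ)^σ ω_i^σ = ξ^{φ_iσ} ω_i^σ` … `S(ι(ξ)^σ)` has the characteristic
roots `ξ^{φ_1σ}, …, ξ^{φ_nσ}`», i.e. `(A^σ, ι^σ)` is of type `(K; {σφ_i})`); used in the proof of the Main Theorem 18.6,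
p. 167 («`(A^σ, ι^σ)` is a c-transform of `(A_i, ι_i)`»), where `σ` fixes the reflex field and `σΦ = Φ`.

## Proof (three tree inputs)

* over `ℂ`: `IsCMTypeRealisation.exists_conjugate` (CMTypeOfConjugateStructure, the Lie/cotangent argument
  `char(Lie(u^σ) | Lie A^σ) = σ(char(Lie u | Lie A))`, AbelianVarietyLieCharpolyBaseChange) gives
  `((A₀ ⊗_L ℂ)^σ, (ι₀ ⊗ ℂ)^σ)` of type `(K; σΦ)`;
* the exchange isomorphism `(A₀^γ) ⊗_L ℂ ≅ (A₀ ⊗_L ℂ)^σ` for `σ` inducing `γ` (B-p12,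
  AbelianVarietyConjugateBaseChangeAlong `AbelianVariety.conjugateBaseChangeAlongIso`), natural in `A₀`, hence
  `𝓞_K`-equivariant;
* transport of the type along an `𝓞_K`-equivariant isomorphism (`IsCMTypeRealisation.exists_of_isIsogeny_to` with
  `IsIsogeny.of_iso`, CMTypeRealisationIsogenyTransport §2–§3).

## References
* [Shimura1998] G. Shimura, *Abelian Varieties with Complex Multiplication and Modular Functions*, Princeton
  (1998), §8.5 p. 89 L1–3 (held chunk p0089); §18.6 p. 167.
* [Milne2005ShimuraVarieties] J. S. Milne, *Introduction to Shimura varieties* (2005), §11 p. 108 («`σ(A, i)` has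
  type `σΦ`»).
-/

set_option autoImplicit false

noncomputable section

open CategoryTheory NumberField
open Literature.AlgebraicGeometry.Motives (CMType AbelianVariety)
open Literature.AlgebraicGeometry.Motives.AbelianVariety
open Literature.AlgebraicGeometry.Motives.HodgeStructure (cmTypeSmul)
open Literature.AlgebraicGeometry.ComplexMultiplication (IsCMTypeRealisation)

namespace Literature.NumberTheory.ComplexMultiplication

section Conjugate

variable {K : Type} [Field K] [NumberField K] [IsCMField K] {Φ : CMType K}
  {L : Type} [Field L] [Algebra L ℂ] {A₀ : AbelianVariety L} {ι₀ : 𝓞 K →+* End A₀}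

/-- **The conjugate `(A₀^γ, ι₀^γ)` of a structure of type `(K, Φ)` over a field `L ⊂ ℂ` is of type `(K, σΦ)` over `L`**, for
`σ ∈ Aut(ℂ)` inducing `γ ∈ Aut(L)` (`σ ∘ (L → ℂ) = (L → ℂ) ∘ γ`): [Shimura1998] §8.5 p. 89 L1–3 («`S(ι(ξ)^σ)` has the
characteristic roots `ξ^{φ_1σ}, …, ξ^{φ_nσ}`»), read over `L` through `(A₀^γ) ⊗_L ℂ ≅ (A₀ ⊗_L ℂ)^σ`.
[cite: Shimura1998, §8.5 p. 89 L1–3] [cite: Milne2005ShimuraVarieties, §11 p. 108] -/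
theorem IsCMTypeRealisationOver.conjugate (h : IsCMTypeRealisationOver Φ A₀ ι₀) (σ : ℂ ≃+* ℂ) (γ : L ≃+* L)
    (hσγ : ∀ x : L, σ (algebraMap L ℂ x) = algebraMap L ℂ (γ x)) :
    IsCMTypeRealisationOver (cmTypeSmul σ Φ) (A₀.conjugate γ) ((A₀.endConjugate γ).comp ι₀) := by
  obtain ⟨θ, hθ⟩ := h
  obtain ⟨θ', hθ'⟩ := hθ.exists_conjugate σ
  exact hθ'.exists_of_isIsogeny_to (IsIsogeny.of_iso (conjugateBaseChangeAlongIso γ σ hσγ A₀)) fun a =>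
    Hom.baseChange_conjugate_comp_conjugateBaseChangeAlongIso_hom γ σ hσγ (ι₀ a : A₀ ⟶ A₀)

end Conjugate

/-- **S8 of the b2 line, binder list verbatim** (`HodgecmMathlib.B2.MainTheoremCMLine.StubConjugateType`, v2c :124–:131):
`theorem stub_conjugateType : StubConjugateType := isCMTypeRealisationOver_conjugate`.
[cite: Shimura1998, §8.5 p. 89 L1–3; §18.6 p. 167] -/
theorem isCMTypeRealisationOver_conjugate :
    ∀ (K : Type) [Field K] [NumberField K] [IsCMField K] (Φ : CMType K)
      (L : Type) [Field L] [NumberField L] [Algebra L ℂ]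
      (A₀ : AbelianVariety L) (ι₀ : 𝓞 K →+* End A₀),
      IsCMTypeRealisationOver Φ A₀ ι₀ →
      ∀ (σ : ℂ ≃+* ℂ) (γ : L ≃+* L),
        (∀ x : L, σ (algebraMap L ℂ x) = algebraMap L ℂ (γ x)) →
        IsCMTypeRealisationOver (cmTypeSmul σ Φ) (A₀.conjugate γ) ((A₀.endConjugate γ).comp ι₀) :=
  fun _ _ _ _ _ _ _ _ _ _ _ h σ γ hσγ => h.conjugate σ γ hσγ

end Literature.NumberTheory.ComplexMultiplication

end
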